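import Summits.KontsevichZagierPeriods.Zeta5Search.Certificates.VIMLevel2K2All
import HarnessLib

/-!
# ζ(5) search — brown9 LEVEL 2 (R-K2) in integer form: the double binomial sum and its `k₃`-recurrence (cell `pub-zeta5`, certifier `cert-1`)

HONEST FRAMING: systematic search; no irrationality claim unless certified.

Consumable form of `VIMLevel2K2(All)` for fam-brown9 / the ttrl2 lane, whose objects are INTEGER binomial sums:
for integers `0 ≤ k₃ ≤ n` every binomial argument in
  `R(n,k₃) = Σ_{k₅≤n} (−1)^{k₅} C(n,k₅) C(3n−k₃−k₅,n) · Σ_{k≤n} (−1)^k C(n,k) C(3n−k₃−k₅−k,n) C(2n−k₅−k,n)`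
is a natural number with a genuine subtraction, and the polynomial-binomial object `VIMInner.Rsum n (k₃ : ℚ)` of the
replay files IS this integer sum (`Rsum_natCast`, via `bp_natCast`/`T_natCast`). Hence the kernel-certified relation
(R-K2) holds for the integer sums: `R_rel_K2_nat` (all `k₃ : ℕ`, `n ≥ 3`; for `k₃ > n` the identity is between the
polynomial-convention values, as in the lane's `VIM.md` §7 'polynomial-convention R'). No named facts.
-/

namespace Summit.KontsevichZagierPeriods.Zeta5Search.Certificates

namespace VIMInner

open Finset

/-- The integer double sum of the lane: `R_ℕ(n,k₃) = Σ_{k₅≤n} (−1)^{k₅} C(n,k₅) C(3n−k₃−k₅,n) · T_ℕ(n; 3n−k₃−k₅, 2n−k₅)`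
with `T_ℕ` the integer inner block (all `ℕ` subtractions). -/
def RsumNat (n k₃ : ℕ) : ℚ :=
  ∑ k₅ ∈ range (n + 1), (-1) ^ k₅ * ((n.choose k₅ : ℕ) : ℚ) * (((3 * n - k₃ - k₅).choose n : ℕ) : ℚ) *
    ∑ k ∈ range (n + 1), (-1) ^ k * ((n.choose k : ℕ) : ℚ) * (((3 * n - k₃ - k₅ - k).choose n : ℕ) : ℚ) *
      (((2 * n - k₅ - k).choose n : ℕ) : ℚ)

/-- **`Rsum n k₃ = R_ℕ(n,k₃)`** for integers `k₃ ≤ n` (every subtraction genuine: `3n−k₃−k₅ ≥ n`, `2n−k₅ ≥ n`). -/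
theorem Rsum_natCast (n k₃ : ℕ) (h : k₃ ≤ n) : Rsum n (k₃ : ℚ) = RsumNat n k₃ := by
  unfold Rsum RsumNat
  refine sum_congr rfl fun k₅ hk₅ => ?_
  have hk₅' : k₅ ≤ n := Nat.lt_succ_iff.mp (mem_range.mp hk₅)
  have hp : n ≤ 3 * n - k₃ - k₅ := by omega
  have hq : n ≤ 2 * n - k₅ := by omega
  have ep : pOf n (k₃ : ℚ) k₅ = ((3 * n - k₃ - k₅ : ℕ) : ℚ) := by
    unfold pOf
    rw [Nat.cast_sub (by omega), Nat.cast_sub (by omega)]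
    push_cast; ring
  have eq : qOf n k₅ = ((2 * n - k₅ : ℕ) : ℚ) := by
    unfold qOf
    rw [Nat.cast_sub (by omega)]
    push_cast; ring
  unfold sR hR
  rw [ep, eq, bp_natCast, T_natCast n _ _ hp hq]

/-- **(R-K2) for the integer sums**: for `n ≥ 3` and every `k₃ : ℕ`,
`η₀₀(n,k₃) R(n,k₃) + η₀₁(n,k₃) R(n,k₃+1) + η₀₂(n,k₃) R(n,k₃+2) = 0` with `R = Rsum n (· : ℚ)` (`= R_ℕ` on `k₃ ≤ n`,
`Rsum_natCast`). -/
theorem R_rel_K2_natArg (n : ℕ) (hn : 3 ≤ n) (k₃ : ℕ) :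
    eta00 n k₃ * Rsum n k₃ + eta01 n k₃ * Rsum n (k₃ + 1) + eta02 n k₃ * Rsum n (k₃ + 2) = 0 :=
  R_rel_K2_all n hn k₃

/-- The same with the three integer sums substituted where they are defined by genuine subtractions
(`k₃ + 2 ≤ n`): `η₀₀ R_ℕ(k₃) + η₀₁ R_ℕ(k₃+1) + η₀₂ R_ℕ(k₃+2) = 0`. -/
theorem R_rel_K2_nat (n k₃ : ℕ) (hn : 3 ≤ n) (hk : k₃ + 2 ≤ n) :
    eta00 n k₃ * RsumNat n k₃ + eta01 n k₃ * RsumNat n (k₃ + 1) + eta02 n k₃ * RsumNat n (k₃ + 2) = 0 := by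
  have h := R_rel_K2_all n hn k₃
  rw [show (k₃ : ℚ) + 1 = ((k₃ + 1 : ℕ) : ℚ) by push_cast; ring,
    show (k₃ : ℚ) + 2 = ((k₃ + 2 : ℕ) : ℚ) by push_cast; ring,
    Rsum_natCast n k₃ (by omega), Rsum_natCast n (k₃ + 1) (by omega), Rsum_natCast n (k₃ + 2) hk] at h
  exact h

end VIMInner

end Summit.KontsevichZagierPeriods.Zeta5Search.Certificates
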